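import Summits.CriticalPhenomena.PercolationContinuityZ3.Theorems.SahiAEOrthantVersion

/-!
# The structure theorem in every dimension, shift step: two nested orthant versions differ by a modular null function

Support file of the Sahi cell (`prim-sahi`, typer seat, generation 23; `--supports stmt-CriticalPhenomena-4575`).
Two small definitions (`baseFactor`, `baseCorrection`), theorems otherwise; no named facts, no sorries.

Setting of `SahiAEOrthantVersion.lean`: `φ : ℝ^ι → ℝ` measurable and supermodular on almost every pair (no bounds),
`S_c` the axis sum through `c`, `g_c = 𝟙_{O_c} exp(φ − S_c)` the orthant density, `F_c` its lower-corner envelope and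
`ψ_c = log F_c + S_c` the orthant version.  For two generic base points `c' < c` (so `O_c ⊆ O_{c'}`):

* `g_{c'} = g_c · U` on `O_c` with the **base factor** `U = exp(S_c − S_{c'})` (`baseFactor`), an everywhere MODULAR
  function (`baseFactor_modular`); if moreover the pair `(c, c')` is generic (`ae_pair_generic`: almost every pair
  is), increasing differences between the two base points make `U` non-decreasing on almost every comparable pair
  (`ae_monotone_baseFactor`);
* hence, by locality and the product formula of `SahiAECornerEnvelopeProduct.lean`,
  `F_{c'} = F_c · cornerEnvelope U` on `O_c` (`cornerEnvelope_orthantDensity_shift`), where `cornerEnvelope U` is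
  modular at every pair (`cornerEnvelope_modular`) and `= U` almost everywhere;
* so `ψ_{c'} = ψ_c + N` on `O_c` (`orthantVersion_shift`) with the **correction**
  `N = log cornerEnvelope U − (S_c − S_{c'})` (`baseCorrection`), which is MODULAR at every pair
  (`baseCorrection_modular`) and ZERO almost everywhere (`baseCorrection_ae_eq_zero`).

Adding a modular function does not affect supermodularity, and adding a null function does not affect being a
version: this is what lets `SahiAEOrthantGluing.lean` glue the orthant versions along `c_k ↓ −∞`.
No sorries, no new axioms.
-/

noncomputable section

namespace Summit.CriticalPhenomena.PercolationContinuityZ3.Theorems.SahiAEFourFunctions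

open MeasureTheory Set Filter Topology Function
open Summit.CriticalPhenomena.PercolationContinuityZ3.Theorems.SahiAESeparableTilt
open scoped ENNReal NNReal

variable {ι : Type*} [Fintype ι] [DecidableEq ι]

/-! ### Generic pairs of base points -/

/-- **Almost every pair of base points is generic**: for almost every `c`, almost every `c'`, every coordinate `i`
and almost every `(r, t)`, the pair `((c; i := r), (c'; i := t))` satisfies the supermodular inequality (pull-back
along the quasi-measure-preserving map `((c, c'), (r, t)) ↦ ((c; i := r), (c'; i := t))`). [this work] -/
theorem ae_pair_generic {φ : (ι → ℝ) → ℝ}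
    (hsm : ∀ᵐ p ∂(volume : Measure (ι → ℝ)).prod volume, φ p.1 + φ p.2 ≤ φ (p.1 ⊓ p.2) + φ (p.1 ⊔ p.2)) :
    ∀ᵐ c ∂(volume : Measure (ι → ℝ)), ∀ᵐ c' ∂(volume : Measure (ι → ℝ)), ∀ i,
      ∀ᵐ rt ∂(volume : Measure ℝ).prod (volume : Measure ℝ),
        φ (update c i rt.1) + φ (update c' i rt.2) ≤
          φ (update c i rt.1 ⊓ update c' i rt.2) + φ (update c i rt.1 ⊔ update c' i rt.2) := by
  have H : ∀ i, ∀ᵐ c ∂(volume : Measure (ι → ℝ)), ∀ᵐ c' ∂(volume : Measure (ι → ℝ)),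
      ∀ᵐ rt ∂(volume : Measure ℝ).prod (volume : Measure ℝ),
        φ (update c i rt.1) + φ (update c' i rt.2) ≤
          φ (update c i rt.1 ⊓ update c' i rt.2) + φ (update c i rt.1 ⊔ update c' i rt.2) := by
    intro i
    have hU := quasiMeasurePreserving_update (ι := ι) i
    have hUU : Measure.QuasiMeasurePreserving
        (Prod.map (fun p : (ι → ℝ) × ℝ => update p.1 i p.2) (fun p : (ι → ℝ) × ℝ => update p.1 i p.2))
        (((volume : Measure (ι → ℝ)).prod (volume : Measure ℝ)).prod
          ((volume : Measure (ι → ℝ)).prod (volume : Measure ℝ)))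
        ((volume : Measure (ι → ℝ)).prod volume) := MeasureTheory.QuasiMeasurePreserving.prodMap hU hU
    have hσ : MeasurePreserving
        (fun w : (ℝ × ℝ) × ((ι → ℝ) × (ι → ℝ)) => ((w.2.1, w.1.1), (w.2.2, w.1.2)))
        (((volume : Measure ℝ).prod (volume : Measure ℝ)).prod
          ((volume : Measure (ι → ℝ)).prod (volume : Measure (ι → ℝ))))
        (((volume : Measure (ι → ℝ)).prod (volume : Measure ℝ)).prod
          ((volume : Measure (ι → ℝ)).prod (volume : Measure ℝ))) :=
      measurePreserving_shuffle (volume : Measure ℝ) (volume : Measure ℝ) (volume : Measure (ι → ℝ))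
        (volume : Measure (ι → ℝ))
    have hsw : MeasurePreserving (Prod.swap : ((ι → ℝ) × (ι → ℝ)) × (ℝ × ℝ) → (ℝ × ℝ) × ((ι → ℝ) × (ι → ℝ)))
        (((volume : Measure (ι → ℝ)).prod (volume : Measure (ι → ℝ))).prod
          ((volume : Measure ℝ).prod (volume : Measure ℝ)))
        (((volume : Measure ℝ).prod (volume : Measure ℝ)).prod
          ((volume : Measure (ι → ℝ)).prod (volume : Measure (ι → ℝ)))) := Measure.measurePreserving_swap
    have hΘ : Measure.QuasiMeasurePreserving
        (fun w : ((ι → ℝ) × (ι → ℝ)) × (ℝ × ℝ) => (update w.1.1 i w.2.1, update w.1.2 i w.2.2))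
        (((volume : Measure (ι → ℝ)).prod (volume : Measure (ι → ℝ))).prod
          ((volume : Measure ℝ).prod (volume : Measure ℝ)))
        ((volume : Measure (ι → ℝ)).prod volume) := by
      have e : (fun w : ((ι → ℝ) × (ι → ℝ)) × (ℝ × ℝ) => (update w.1.1 i w.2.1, update w.1.2 i w.2.2)) =
          (Prod.map (fun p : (ι → ℝ) × ℝ => update p.1 i p.2) (fun p : (ι → ℝ) × ℝ => update p.1 i p.2)) ∘
            (fun w : (ℝ × ℝ) × ((ι → ℝ) × (ι → ℝ)) => ((w.2.1, w.1.1), (w.2.2, w.1.2))) ∘ Prod.swap := by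
        funext w; rfl
      rw [e]
      exact (hUU.comp hσ.quasiMeasurePreserving).comp hsw.quasiMeasurePreserving
    have h1 : ∀ᵐ w ∂(((volume : Measure (ι → ℝ)).prod (volume : Measure (ι → ℝ))).prod
        ((volume : Measure ℝ).prod (volume : Measure ℝ))),
        φ (update w.1.1 i w.2.1) + φ (update w.1.2 i w.2.2) ≤
          φ (update w.1.1 i w.2.1 ⊓ update w.1.2 i w.2.2) + φ (update w.1.1 i w.2.1 ⊔ update w.1.2 i w.2.2) := by
      filter_upwards [hΘ.ae hsm] with w hw
      exact hw
    have h2 : ∀ᵐ cc : (ι → ℝ) × (ι → ℝ) ∂(volume : Measure (ι → ℝ)).prod (volume : Measure (ι → ℝ)),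
        ∀ᵐ rt : ℝ × ℝ ∂(volume : Measure ℝ).prod (volume : Measure ℝ),
          φ (update cc.1 i rt.1) + φ (update cc.2 i rt.2) ≤
            φ (update cc.1 i rt.1 ⊓ update cc.2 i rt.2) + φ (update cc.1 i rt.1 ⊔ update cc.2 i rt.2) := by
      have h2' := Measure.ae_ae_of_ae_prod (p := fun w : ((ι → ℝ) × (ι → ℝ)) × (ℝ × ℝ) =>
        φ (update w.1.1 i w.2.1) + φ (update w.1.2 i w.2.2) ≤
          φ (update w.1.1 i w.2.1 ⊓ update w.1.2 i w.2.2) + φ (update w.1.1 i w.2.1 ⊔ update w.1.2 i w.2.2)) h1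
      filter_upwards [h2'] with cc hcc
      filter_upwards [hcc] with rt hrt
      exact hrt
    have h3 := Measure.ae_ae_of_ae_prod (p := fun cc : (ι → ℝ) × (ι → ℝ) =>
      ∀ᵐ rt : ℝ × ℝ ∂(volume : Measure ℝ).prod (volume : Measure ℝ),
        φ (update cc.1 i rt.1) + φ (update cc.2 i rt.2) ≤
          φ (update cc.1 i rt.1 ⊓ update cc.2 i rt.2) + φ (update cc.1 i rt.1 ⊔ update cc.2 i rt.2)) h2
    filter_upwards [h3] with c hc
    filter_upwards [hc] with c' hc'
    exact hc'
  filter_upwards [ae_all_iff.2 H] with c hc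
  exact ae_all_iff.2 hc

/-! ### The base factor between two base points -/

/-- **The base factor** `U = exp(S_c − S_{c'})` between two base points. [this work] -/
def baseFactor (φ : (ι → ℝ) → ℝ) (c c' : ι → ℝ) : (ι → ℝ) → ℝ≥0∞ := fun x =>
  ENNReal.ofReal (Real.exp (axisSum φ c x - axisSum φ c' x))

/-- The base factor is measurable. [folklore] -/
theorem measurable_baseFactor {φ : (ι → ℝ) → ℝ} (hφ : Measurable φ) (c c' : ι → ℝ) :
    Measurable (baseFactor φ c c') :=
  ENNReal.measurable_ofReal.comp (Real.measurable_exp.comp ((measurable_axisSum hφ c).sub (measurable_axisSum hφ c')))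

/-- The base factor is non-zero. [folklore] -/
theorem baseFactor_ne_zero (φ : (ι → ℝ) → ℝ) (c c' x : ι → ℝ) : baseFactor φ c c' x ≠ 0 :=
  (ENNReal.ofReal_pos.2 (Real.exp_pos _)).ne'

/-- The base factor is finite. [folklore] -/
theorem baseFactor_ne_top (φ : (ι → ℝ) → ℝ) (c c' x : ι → ℝ) : baseFactor φ c c' x ≠ ∞ := ENNReal.ofReal_ne_top

/-- The real value of the base factor. [folklore] -/
theorem toReal_baseFactor (φ : (ι → ℝ) → ℝ) (c c' x : ι → ℝ) :
    (baseFactor φ c c' x).toReal = Real.exp (axisSum φ c x - axisSum φ c' x) :=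
  ENNReal.toReal_ofReal (Real.exp_pos _).le

/-- **The base factor is modular** at every pair (the axis sums are). [this work] -/
theorem baseFactor_modular (φ : (ι → ℝ) → ℝ) (c c' x y : ι → ℝ) :
    baseFactor φ c c' x * baseFactor φ c c' y = baseFactor φ c c' (x ⊓ y) * baseFactor φ c c' (x ⊔ y) := by
  simp only [baseFactor]
  rw [← ENNReal.ofReal_mul (Real.exp_pos _).le, ← ENNReal.ofReal_mul (Real.exp_pos _).le, ← Real.exp_add,
    ← Real.exp_add]
  congr 2
  linarith [axisSum_modular φ c x y, axisSum_modular φ c' x y]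

/-- **The orthant densities above nested base points differ by the base factor**: `g_{c'} = g_c · U` on `O_c` for
`c' ≤ c`. [this work] -/
theorem orthantDensity_eq_mul_baseFactor {φ : (ι → ℝ) → ℝ} {c c' : ι → ℝ} (hcc' : c' ≤ c) {x : ι → ℝ}
    (hx : x ∈ Set.pi univ fun i => Ioi (c i)) :
    orthantDensity φ c' x = orthantDensity φ c x * baseFactor φ c c' x := by
  rw [orthantDensity_of_mem hx, orthantDensity_of_mem (orthant_subset_orthant hcc' hx), baseFactor,
    ← ENNReal.ofReal_mul (Real.exp_pos _).le, ← Real.exp_add]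
  congr 2
  ring

/-- The logarithm of the base factor as a sum of increments of axis sections. [folklore] -/
theorem axisSum_sub_axisSum (φ : (ι → ℝ) → ℝ) (c c' x : ι → ℝ) :
    axisSum φ c x - axisSum φ c' x =
      ∑ i, (φ (update c i (x i)) - φ (update c' i (x i))) - ((Fintype.card ι : ℝ) - 1) * (φ c - φ c') := by
  simp only [axisSum, Finset.sum_sub_distrib]
  ring

/-- **For a generic pair of base points `c' ≤ c` the base factor is non-decreasing on almost every comparable pair**
(increasing differences between the two base points: `φ(c; i := r) − φ(c'; i := r)` is non-decreasing in `r`).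
[this work] -/
theorem ae_monotone_baseFactor {φ : (ι → ℝ) → ℝ} {c c' : ι → ℝ} (hcc' : c' ≤ c)
    (hpair : ∀ i, ∀ᵐ rt ∂(volume : Measure ℝ).prod (volume : Measure ℝ),
      φ (update c i rt.1) + φ (update c' i rt.2) ≤
        φ (update c i rt.1 ⊓ update c' i rt.2) + φ (update c i rt.1 ⊔ update c' i rt.2)) :
    ∀ᵐ p ∂(volume : Measure (ι → ℝ)).prod volume, p.1 ≤ p.2 → baseFactor φ c c' p.1 ≤ baseFactor φ c c' p.2 := by
  have H : ∀ i, ∀ᵐ p : (ι → ℝ) × (ι → ℝ) ∂(volume : Measure (ι → ℝ)).prod volume, p.1 i ≤ p.2 i →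
      φ (update c i (p.1 i)) - φ (update c' i (p.1 i)) ≤ φ (update c i (p.2 i)) - φ (update c' i (p.2 i)) := by
    intro i
    have h1 : ∀ᵐ rt ∂(volume : Measure ℝ).prod (volume : Measure ℝ), rt.1 ≤ rt.2 →
        φ (update c i rt.1) - φ (update c' i rt.1) ≤ φ (update c i rt.2) - φ (update c' i rt.2) := by
      filter_upwards [hpair i] with rt h hle
      rw [inf_comm, update_inf_update_of_le hcc' hle i, sup_comm, update_sup_update_of_le hcc' hle i] at h
      linarith
    have hq : Measure.QuasiMeasurePreserving (Prod.map (fun x : ι → ℝ => x i) (fun x : ι → ℝ => x i))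
        ((volume : Measure (ι → ℝ)).prod volume) ((volume : Measure ℝ).prod (volume : Measure ℝ)) :=
      MeasureTheory.QuasiMeasurePreserving.prodMap (quasiMeasurePreserving_eval i) (quasiMeasurePreserving_eval i)
    filter_upwards [hq.ae h1] with p hp using hp
  filter_upwards [ae_all_iff.2 H] with p hp hle
  simp only [baseFactor]
  refine ENNReal.ofReal_le_ofReal (Real.exp_le_exp.2 ?_)
  rw [axisSum_sub_axisSum, axisSum_sub_axisSum]
  have hs : ∑ i, (φ (update c i (p.1 i)) - φ (update c' i (p.1 i))) ≤
      ∑ i, (φ (update c i (p.2 i)) - φ (update c' i (p.2 i))) :=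
    Finset.sum_le_sum fun i _ => hp i (hle i)
  linarith

/-- The corner essential suprema of a monotone base factor are finite. [folklore] -/
theorem cornerEssSup_baseFactor_ne_top {φ : (ι → ℝ) → ℝ} {c c' : ι → ℝ}
    (hmono : ∀ᵐ p ∂(volume : Measure (ι → ℝ)).prod volume,
      p.1 ≤ p.2 → baseFactor φ c c' p.1 ≤ baseFactor φ c c' p.2) (n : ℕ) (p : ι → ℝ) :
    cornerEssSup (baseFactor φ c c') n p ≠ ∞ :=
  cornerEssSup_ne_top_of_local (local_bound_of_ae_monotone (baseFactor_ne_top φ c c') hmono) n p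

/-- The envelope of a monotone base factor is finite. [folklore] -/
theorem cornerEnvelope_baseFactor_ne_top {φ : (ι → ℝ) → ℝ} {c c' : ι → ℝ}
    (hmono : ∀ᵐ p ∂(volume : Measure (ι → ℝ)).prod volume,
      p.1 ≤ p.2 → baseFactor φ c c' p.1 ≤ baseFactor φ c c' p.2) (p : ι → ℝ) :
    cornerEnvelope (baseFactor φ c c') p ≠ ∞ :=
  cornerEnvelope_ne_top (cornerEssSup_baseFactor_ne_top hmono 0 p)

/-- The envelope of a monotone base factor is non-zero. [folklore] -/
theorem cornerEnvelope_baseFactor_ne_zero {φ : (ι → ℝ) → ℝ} (hφ : Measurable φ) {c c' : ι → ℝ}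
    (hmono : ∀ᵐ p ∂(volume : Measure (ι → ℝ)).prod volume,
      p.1 ≤ p.2 → baseFactor φ c c' p.1 ≤ baseFactor φ c c' p.2) (p : ι → ℝ) :
    cornerEnvelope (baseFactor φ c c') p ≠ 0 :=
  cornerEnvelope_ne_zero_of_ae_monotone' (measurable_baseFactor hφ c c') hmono (baseFactor_ne_zero φ c c') p

/-- The real value of the envelope of a monotone base factor is positive. [folklore] -/
theorem toReal_cornerEnvelope_baseFactor_pos {φ : (ι → ℝ) → ℝ} (hφ : Measurable φ) {c c' : ι → ℝ}
    (hmono : ∀ᵐ p ∂(volume : Measure (ι → ℝ)).prod volume,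
      p.1 ≤ p.2 → baseFactor φ c c' p.1 ≤ baseFactor φ c c' p.2) (p : ι → ℝ) :
    0 < (cornerEnvelope (baseFactor φ c c') p).toReal :=
  ENNReal.toReal_pos (cornerEnvelope_baseFactor_ne_zero hφ hmono p) (cornerEnvelope_baseFactor_ne_top hmono p)

/-! ### The shift of the envelopes and of the versions -/

/-- **Shift of the envelopes**: for generic nested base points `c' < c` with a generic pair,
`F_{c'}(p) = F_c(p) · cornerEnvelope U (p)` for every `p ∈ O_c` (locality of the envelope + the product formula).
[this work] -/
theorem cornerEnvelope_orthantDensity_shift {φ : (ι → ℝ) → ℝ} (hφ : Measurable φ) {c c' : ι → ℝ}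
    (hlt : ∀ i, c' i < c i)
    (hc : ∀ i, ∀ᵐ q ∂(volume : Measure (ι → ℝ)).prod (volume : Measure ℝ),
      φ (update c i q.2) + φ q.1 ≤ φ (update c i q.2 ⊓ q.1) + φ (update c i q.2 ⊔ q.1))
    (hpair : ∀ i, ∀ᵐ rt ∂(volume : Measure ℝ).prod (volume : Measure ℝ),
      φ (update c i rt.1) + φ (update c' i rt.2) ≤
        φ (update c i rt.1 ⊓ update c' i rt.2) + φ (update c i rt.1 ⊔ update c' i rt.2))
    {p : ι → ℝ} (hp : p ∈ Set.pi univ fun i => Ioi (c i)) :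
    cornerEnvelope (orthantDensity φ c') p =
      cornerEnvelope (orthantDensity φ c) p * cornerEnvelope (baseFactor φ c c') p := by
  have hcc' : c' ≤ c := fun i => (hlt i).le
  have hUmono := ae_monotone_baseFactor (φ := φ) hcc' hpair
  -- a corner box at `p` inside `O_c`
  have hgap : ∀ i, ∀ᶠ n in atTop, cornerRadius n < p i - c i := fun i =>
    eventually_cornerRadius_lt (by have := mem_orthant_iff.1 hp i; linarith)
  obtain ⟨n₀, hn₀⟩ := (eventually_all.2 hgap).exists
  have hsub : ∀ y ∈ (Set.pi univ fun i => Ioc (p i - cornerRadius n₀) (p i)), y ∈ Set.pi univ fun i => Ioi (c i) :=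
    fun y hy => mem_orthant_iff.2 fun i => by
      have h1 := (Set.mem_univ_pi.1 hy i).1
      have h2 := hn₀ i
      linarith
  rw [cornerEnvelope_congr_of_eqOn (g := fun y => orthantDensity φ c y * baseFactor φ c c' y) n₀
    (fun y hy => orthantDensity_eq_mul_baseFactor hcc' (hsub y hy))]
  exact cornerEnvelope_mul_of_ae_monotone (measurable_baseFactor hφ c c') hUmono
    (cornerEssSup_orthantDensity_ne_top (ae_monotone_orthantDensity hc) 0 p) (cornerEssSup_baseFactor_ne_top hUmono 0 p)

/-- **The correction** `N = log cornerEnvelope U − (S_c − S_{c'})` between two base points. [this work] -/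
def baseCorrection (φ : (ι → ℝ) → ℝ) (c c' : ι → ℝ) : (ι → ℝ) → ℝ := fun x =>
  Real.log (cornerEnvelope (baseFactor φ c c') x).toReal - (axisSum φ c x - axisSum φ c' x)

/-- The correction is measurable. [folklore] -/
theorem measurable_baseCorrection {φ : (ι → ℝ) → ℝ} (hφ : Measurable φ) (c c' : ι → ℝ) :
    Measurable (baseCorrection φ c c') :=
  (Real.measurable_log.comp (ENNReal.measurable_toReal.comp
    (measurable_cornerEnvelope (measurable_baseFactor hφ c c')))).sub
    ((measurable_axisSum hφ c).sub (measurable_axisSum hφ c'))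

/-- **The correction is modular at every pair** (the envelope of the modular base factor is modular,
`cornerEnvelope_modular`; the axis sums are modular). [this work] -/
theorem baseCorrection_modular {φ : (ι → ℝ) → ℝ} (hφ : Measurable φ) {c c' : ι → ℝ}
    (hmono : ∀ᵐ p ∂(volume : Measure (ι → ℝ)).prod volume,
      p.1 ≤ p.2 → baseFactor φ c c' p.1 ≤ baseFactor φ c c' p.2) (x y : ι → ℝ) :
    baseCorrection φ c c' x + baseCorrection φ c c' y =
      baseCorrection φ c c' (x ⊓ y) + baseCorrection φ c c' (x ⊔ y) := by
  set F := cornerEnvelope (baseFactor φ c c') with hF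
  have hmod := cornerEnvelope_modular (measurable_baseFactor hφ c c') (baseFactor_modular φ c c')
    (fun p => cornerEssSup_baseFactor_ne_top hmono 0 p) x y
  have hpos : ∀ p, 0 < (F p).toReal := fun p => toReal_cornerEnvelope_baseFactor_pos hφ hmono p
  have hR : (F x).toReal * (F y).toReal = (F (x ⊓ y)).toReal * (F (x ⊔ y)).toReal := by
    rw [← ENNReal.toReal_mul, ← ENNReal.toReal_mul, hF, hmod]
  have hlog : Real.log (F x).toReal + Real.log (F y).toReal =
      Real.log (F (x ⊓ y)).toReal + Real.log (F (x ⊔ y)).toReal := by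
    rw [← Real.log_mul (hpos x).ne' (hpos y).ne', ← Real.log_mul (hpos _).ne' (hpos _).ne', hR]
  simp only [baseCorrection, ← hF]
  linarith [axisSum_modular φ c x y, axisSum_modular φ c' x y]

/-- **The correction vanishes almost everywhere** (the envelope is a version of the base factor). [this work] -/
theorem baseCorrection_ae_eq_zero {φ : (ι → ℝ) → ℝ} (hφ : Measurable φ) {c c' : ι → ℝ}
    (hmono : ∀ᵐ p ∂(volume : Measure (ι → ℝ)).prod volume,
      p.1 ≤ p.2 → baseFactor φ c c' p.1 ≤ baseFactor φ c c' p.2) :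
    ∀ᵐ x ∂(volume : Measure (ι → ℝ)), baseCorrection φ c c' x = 0 := by
  filter_upwards [cornerEnvelope_ae_eq (measurable_baseFactor hφ c c') hmono] with x hx
  simp only [baseCorrection]
  rw [hx, toReal_baseFactor, Real.log_exp, sub_self]

/-- **Shift of the orthant versions**: `ψ_{c'} = ψ_c + N` on `O_c`. [this work] -/
theorem orthantVersion_shift {φ : (ι → ℝ) → ℝ} (hφ : Measurable φ) {c c' : ι → ℝ} (hlt : ∀ i, c' i < c i)
    (hc : ∀ i, ∀ᵐ q ∂(volume : Measure (ι → ℝ)).prod (volume : Measure ℝ),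
      φ (update c i q.2) + φ q.1 ≤ φ (update c i q.2 ⊓ q.1) + φ (update c i q.2 ⊔ q.1))
    (hpair : ∀ i, ∀ᵐ rt ∂(volume : Measure ℝ).prod (volume : Measure ℝ),
      φ (update c i rt.1) + φ (update c' i rt.2) ≤
        φ (update c i rt.1 ⊓ update c' i rt.2) + φ (update c i rt.1 ⊔ update c' i rt.2))
    {p : ι → ℝ} (hp : p ∈ Set.pi univ fun i => Ioi (c i)) :
    orthantVersion φ c' p = orthantVersion φ c p + baseCorrection φ c c' p := by
  have hcc' : c' ≤ c := fun i => (hlt i).le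
  have hUmono := ae_monotone_baseFactor (φ := φ) hcc' hpair
  have hshift := cornerEnvelope_orthantDensity_shift hφ hlt hc hpair hp
  have hFpos : 0 < (cornerEnvelope (orthantDensity φ c) p).toReal :=
    ENNReal.toReal_pos (cornerEnvelope_orthantDensity_ne_zero hφ hc hp)
      (cornerEnvelope_ne_top (cornerEssSup_orthantDensity_ne_top (ae_monotone_orthantDensity hc) 0 p))
  have hUpos := toReal_cornerEnvelope_baseFactor_pos hφ hUmono p
  simp only [orthantVersion, baseCorrection]
  rw [hshift, ENNReal.toReal_mul, Real.log_mul hFpos.ne' hUpos.ne']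
  ring

end Summit.CriticalPhenomena.PercolationContinuityZ3.Theorems.SahiAEFourFunctions
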